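import Mathlib
import HarnessLib
import Literature.Analysis.FluidPDE.ClassicalSolution
import Literature.Analysis.FluidPDE.LerayHopf
import Literature.Analysis.FluidPDE.SuitableWeak
import Summits.NavierStokesRegularity.NavierStokesRegularity.Theses.QuarterJolt
import Summits.NavierStokesRegularity.NavierStokesRegularity.Theorems.QuarterJoltEdgeLawSlab
import Summits.NavierStokesRegularity.NavierStokesRegularity.Theorems.QuarterJoltJoltFlatCell
import Summits.NavierStokesRegularity.NavierStokesRegularity.Theorems.QuarterJoltTerminalJoltLaw
import Summits.NavierStokesRegularity.NavierStokesRegularity.Theorems.LerayQuarterDissipationRecordTimeTypeI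

/-!
# Route QuarterJolt — crux `NoTerminalJolt` (stmt-NavierStokesRegularity-26463): the EDGE LAW, IV.
# `EnstrophyQuarterLaw ⇒ D = O(1)`: the quarter law reaches exactly the edge `α = 1/4`

Seat ns-qj-p1 g2 (route QuarterJolt supports; `--supports 26463 --as helper`; planner of record
ns-idea-9, LEAD of the crux ns-ntj-p1 g0, refuter audit refuter1-g10, critic idea-crit-8 V25).
Last of four files; the analysis is in `QuarterJoltEdgeLawSlice/Class/Slab`.

THE STATEMENTS (frame of the crux: `ν > 0`, `T > 0`, `(u, p)` classical on `[0, T) × ℝ³`, Leray–Hopf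
on `[0, T]` from the rapidly decaying datum `u 0`; jolt functional
`D(t) = (√(T−t))⁻¹ ∫‖u(t) − u(T)‖²`, `u(T)` the Leray–Hopf value):

* `NoTerminalJolt.edgeLaw` — the slice law `∫|curl u(t)|² ≤ K/√(T−t)` on `[0,T)` gives `∃ C,
  D(t) ≤ C` for all `t < T` close to `T` (the Type-I rate is supplied by the landed item
  `RecordTimeTypeI`, stmt-22145, `RecordTimeTypeI.main`); `isBigO_integral_norm_sub_sq` — the same
  as `∫‖u(t) − u(T)‖² = O(√(T−t))` (`t ↑ T`);
* `NoTerminalJolt.edgeLaw_lintegral` — the same in the lower-integral window form which is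
  LITERALLY the body of the obligation `EdgeLaw` of line `Cruxes/EnstrophyQuarterLaw/Lines/
  trace_transfer.lean` (ns-idea-9 LINE 9, stub `stub_edgeLaw`, «shared with the NoTerminalJolt
  lead's plan»): that stub is this theorem;
* `NoTerminalJolt.edgeLaw_of_enstrophyQuarterLaw` — with the shelf crux
  `Theses.QuarterJolt.EnstrophyQuarterLaw` BY NAME as hypothesis: a maximal solution has bounded `D`;
* `NoTerminalJolt.joltWindow_of_enstrophyQuarterLaw` — THE CALIBRATION: given `EnstrophyQuarterLaw`,
  at a first blow-up time `0 < limsup_{t↑T} D(t)` (the terminal jolt law `terminalJoltLaw`, p619871,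
  i.e. the supports `JoltFlatCell`/`NoFlatCellVertex` and ε-regularity) AND `limsup_{t↑T} D(t) < ∞`
  (the edge law). The crux `NoTerminalJolt` asks `D → 0`: given EQL it is exactly the emptiness of
  this window, one notch (`o` versus `O` at `α = 1/4`) beyond what the quarter law itself yields —
  the route header's claim «Type I alone gives only O((T−t)^(1/4))», now a theorem.

WHY THE METHOD STOPS AT THE EDGE (for the planners): in the balance of `w = u − u(t)` the frozen
slice `u(t)` is not transported, so the transport pairing `⟪(u·∇)u, u(t) − u⟫` is paid by
`‖u‖_∞‖∇u‖₂‖w‖₂ ~ (T−τ)^{-3/4}‖w‖₂`, which integrates to exactly `(T−t)^{1/4}`; any `o(·)` would need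
either decay of the Type-I constant (`‖u(τ)‖_∞ √(T−τ) → 0`, which is regularity by the
ε-regularity supports) or cancellation in the transport term — the equation-specific input the
crux demands.

HONEST FRAMING: conditional statements about a HYPOTHETICAL quarter-law blow-up. Nothing here proves
`EnstrophyQuarterLaw` (stmt-1574), `NoTerminalJolt` (stmt-26463) or Navier–Stokes regularity; all
three stay OPEN, and this file claims no progress on them. No summit statement is proved here.
Lint note: importing `LerayQuarterDissipationRecordTimeTypeI` (which imports
`Theses.LerayQuarterDissipation`) carries the known `theses-cone` advisory, as for the route's other
landed files (`QuarterJoltJoltFlatCell`, `QuarterJoltTerminalJoltLaw`). [folklore]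
-/

noncomputable section

-- the summit and its single sub-problem share the name (CONVENTIONS §1), as in every Theorems file
set_option linter.dupNamespace false

namespace Summit.NavierStokesRegularity.NavierStokesRegularity.Theorems

open MeasureTheory Set Function Filter Topology
open scoped ENNReal NNReal
open Literature.Analysis.FluidPDE

/-- **THE EDGE LAW** (route QuarterJolt, crux `NoTerminalJolt`; LEAD plan `Lines/regular_split.md`
§EDGE LAW): in the frame of the crux — `(u, p)` classical on `[0, T) × ℝ³`, Leray–Hopf on `[0, T]`
from a rapidly decaying datum — the slice law `∫|curl u(t)|² ≤ K/√(T−t)` on `[0, T)` (the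
conclusion of the shelf crux `EnstrophyQuarterLaw`) forces the jolt functional
`D(t) = (√(T−t))⁻¹ ∫‖u(t) − u(T)‖²` to be BOUNDED as `t ↑ T`. The Type-I rate needed by
`EdgeLaw.integral_norm_sub_sq_le` is supplied by the landed item `RecordTimeTypeI` (stmt-22145,
`RecordTimeTypeI.main`). So the quarter law reaches exactly the edge `α = 1/4` of the family
`‖u(t) − u(T)‖₂ = O((T−t)^α)`; the crux `NoTerminalJolt` (`D → 0`) is one notch beyond, and at a first
blow-up time `terminalJoltLaw` shows `D ↛ 0` under the same slice law. Nothing here proves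
`EnstrophyQuarterLaw`, `NoTerminalJolt` or Navier–Stokes regularity. [folklore] -/
theorem NoTerminalJolt.edgeLaw {ν T K : ℝ} (hν : 0 < ν) (hT : 0 < T)
    {u : ℝ → EuclideanSpace ℝ (Fin 3) → EuclideanSpace ℝ (Fin 3)}
    {p : ℝ → EuclideanSpace ℝ (Fin 3) → ℝ}
    (hsol : IsClassicalNSSolutionOn (Ico 0 T) ν 0 u p) (hLH : IsLerayHopfOn T ν 0 (u 0) u)
    (hdec : HasRapidSpatialDecay (u 0))
    (hslice : ∀ t ∈ Ico 0 T, ∫⁻ x, ‖curl (u t) x‖ₑ ^ 2 ≤ ENNReal.ofReal (K / Real.sqrt (T - t))) :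
    ∃ C : ℝ, ∀ᶠ t in 𝓝[<] T, (Real.sqrt (T - t))⁻¹ * ∫ x, ‖u t x - u T x‖ ^ 2 ≤ C := by
  obtain ⟨D, T₁, -, -, hT₁T, hD⟩ := EdgeLaw.exists_integral_norm_sub_sq_le_of_isTypeIBlowup hν hT
    hsol hLH hdec hslice (RecordTimeTypeI.main hν hT hsol hLH hdec K hslice)
  refine ⟨D, ?_⟩
  filter_upwards [Ioo_mem_nhdsLT hT₁T] with t ht
  have hsq : 0 < Real.sqrt (T - t) := Real.sqrt_pos.2 (sub_pos.2 ht.2)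
  rw [inv_mul_le_iff₀ hsq, mul_comm]
  exact hD t ht

/-- **THE EDGE LAW, `O`-form**: in the frame of the crux with the slice law,
`∫‖u(t) − u(T)‖² = O(√(T−t))` as `t ↑ T`. [folklore] -/
theorem NoTerminalJolt.isBigO_integral_norm_sub_sq {ν T K : ℝ} (hν : 0 < ν) (hT : 0 < T)
    {u : ℝ → EuclideanSpace ℝ (Fin 3) → EuclideanSpace ℝ (Fin 3)}
    {p : ℝ → EuclideanSpace ℝ (Fin 3) → ℝ}
    (hsol : IsClassicalNSSolutionOn (Ico 0 T) ν 0 u p) (hLH : IsLerayHopfOn T ν 0 (u 0) u)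
    (hdec : HasRapidSpatialDecay (u 0))
    (hslice : ∀ t ∈ Ico 0 T, ∫⁻ x, ‖curl (u t) x‖ₑ ^ 2 ≤ ENNReal.ofReal (K / Real.sqrt (T - t))) :
    (fun t => ∫ x, ‖u t x - u T x‖ ^ 2) =O[𝓝[<] T] (fun t => Real.sqrt (T - t)) := by
  obtain ⟨D, T₁, -, -, hT₁T, hD⟩ := EdgeLaw.exists_integral_norm_sub_sq_le_of_isTypeIBlowup hν hT
    hsol hLH hdec hslice (RecordTimeTypeI.main hν hT hsol hLH hdec K hslice)
  refine Asymptotics.IsBigO.of_bound D ?_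
  filter_upwards [Ioo_mem_nhdsLT hT₁T] with t ht
  rw [Real.norm_of_nonneg (integral_nonneg fun _ => sq_nonneg _),
    Real.norm_of_nonneg (Real.sqrt_nonneg _)]
  exact hD t ht

/-- **THE EDGE LAW, lower-integral window form** — literally the body of the obligation `EdgeLaw` of
line `Cruxes/EnstrophyQuarterLaw/Lines/trace_transfer.lean` (ns-idea-9, stub `stub_edgeLaw`, shared
with the `NoTerminalJolt` LEAD plan): frame + slice law `K` ⇒ `∃ D t₀, 0 ≤ t₀ < T ∧ ∀ s ∈ [t₀, T),
∫⁻‖u(s) − u(T)‖ₑ² ≤ ofReal (D √(T−s))`. [folklore] -/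
theorem NoTerminalJolt.edgeLaw_lintegral :
    ∀ (ν T : ℝ), 0 < ν → 0 < T →
      ∀ (u : ℝ → EuclideanSpace ℝ (Fin 3) → EuclideanSpace ℝ (Fin 3))
        (p : ℝ → EuclideanSpace ℝ (Fin 3) → ℝ),
        IsClassicalNSSolutionOn (Set.Ico 0 T) ν 0 u p → IsLerayHopfOn T ν 0 (u 0) u →
        HasRapidSpatialDecay (u 0) → ∀ K : ℝ,
        (∀ t ∈ Set.Ico 0 T, ∫⁻ x, ‖curl (u t) x‖ₑ ^ 2 ≤ ENNReal.ofReal (K / Real.sqrt (T - t))) →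
        ∃ D t₀ : ℝ, 0 ≤ t₀ ∧ t₀ < T ∧ ∀ s ∈ Set.Ico t₀ T,
          ∫⁻ x, ‖u s x - u T x‖ₑ ^ 2 ≤ ENNReal.ofReal (D * Real.sqrt (T - s)) := by
  intro ν T hν hT u p hsol hLH hdec K hslice
  obtain ⟨D, T₁, -, hT₁0, hT₁T, hD⟩ := EdgeLaw.exists_integral_norm_sub_sq_le_of_isTypeIBlowup hν hT
    hsol hLH hdec hslice (RecordTimeTypeI.main hν hT hsol hLH hdec K hslice)
  refine ⟨D, (T₁ + T) / 2, by linarith, by linarith, fun s hs => ?_⟩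
  have hs' : s ∈ Ioo T₁ T := ⟨by linarith [hs.1], hs.2⟩
  have hmem : MemLp (fun x => u s x - u T x) 2 volume :=
    (hLH.memLp s ⟨by linarith [hs.1], hs.2.le⟩).sub (hLH.memLp T ⟨hT.le, le_rfl⟩)
  rw [JoltFlatCell.lintegral_enorm_sq_eq_ofReal hmem]
  exact ENNReal.ofReal_le_ofReal (hD s hs')

/-- **EQL ⇒ the edge law** (the shelf crux `Theses.QuarterJolt.EnstrophyQuarterLaw`, BY NAME, as a
hypothesis): a maximal classical Leray–Hopf solution from a rapidly decaying datum has a BOUNDED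
jolt functional near its blow-up time `T`. Conditional on the OPEN crux; nothing is asserted about
it. [folklore] -/
theorem NoTerminalJolt.edgeLaw_of_enstrophyQuarterLaw
    (hQ : Theses.QuarterJolt.EnstrophyQuarterLaw) {ν T : ℝ} (hν : 0 < ν) (hT : 0 < T)
    {u : ℝ → EuclideanSpace ℝ (Fin 3) → EuclideanSpace ℝ (Fin 3)}
    {p : ℝ → EuclideanSpace ℝ (Fin 3) → ℝ}
    (hmax : IsMaximalSmoothSolution ν 0 u p T) (hLH : IsLerayHopfOn T ν 0 (u 0) u)
    (hdec : HasRapidSpatialDecay (u 0)) :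
    ∃ C : ℝ, ∀ᶠ t in 𝓝[<] T, (Real.sqrt (T - t))⁻¹ * ∫ x, ‖u t x - u T x‖ ^ 2 ≤ C := by
  obtain ⟨K, hK⟩ := hQ ν T hν hT u p hmax hLH hdec
  exact NoTerminalJolt.edgeLaw hν hT hmax.1 hLH hdec hK

/-- **THE JOLT WINDOW under EQL** (calibration of the crux, BY NAME): if
`Theses.QuarterJolt.EnstrophyQuarterLaw` holds, then at a first blow-up time `T` of a classical
Leray–Hopf solution from a rapidly decaying datum the jolt functional `D(t)` satisfies BOTH
`limsup_{t↑T} D(t) > 0` (`terminalJoltLaw`, p619871: the supports `JoltFlatCell`/`NoFlatCellVertex`)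
AND `limsup_{t↑T} D(t) < ∞` (the edge law). The crux `NoTerminalJolt` asks `D → 0`; so, GIVEN EQL, the
crux at blow-up times is exactly the statement that this window is empty, i.e. that no blow-up
occurs. Conditional on the OPEN crux EQL; no summit statement is proved. [folklore] -/
theorem NoTerminalJolt.joltWindow_of_enstrophyQuarterLaw
    (hQ : Theses.QuarterJolt.EnstrophyQuarterLaw) {ν T : ℝ} (hν : 0 < ν) (hT : 0 < T)
    {u : ℝ → EuclideanSpace ℝ (Fin 3) → EuclideanSpace ℝ (Fin 3)}
    {p : ℝ → EuclideanSpace ℝ (Fin 3) → ℝ}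
    (hmax : IsMaximalSmoothSolution ν 0 u p T) (hLH : IsLerayHopfOn T ν 0 (u 0) u)
    (hdec : HasRapidSpatialDecay (u 0)) :
    (∃ ε : ℝ, 0 < ε ∧
        ∃ᶠ t in 𝓝[<] T, ε ≤ (Real.sqrt (T - t))⁻¹ * ∫ x, ‖u t x - u T x‖ ^ 2) ∧
      ∃ C : ℝ, ∀ᶠ t in 𝓝[<] T, (Real.sqrt (T - t))⁻¹ * ∫ x, ‖u t x - u T x‖ ^ 2 ≤ C := by
  obtain ⟨K, hK⟩ := hQ ν T hν hT u p hmax hLH hdec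
  exact ⟨exists_frequently_le_joltFunctional hν hT hmax hLH hdec hK,
    NoTerminalJolt.edgeLaw hν hT hmax.1 hLH hdec hK⟩

end Summit.NavierStokesRegularity.NavierStokesRegularity.Theorems

end
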